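import Mathlib
import HarnessLib

/-!
# Route `KLProgramme` — engine support, route (L2), FAT layer 5a: scalar inequalities for the closed form of `α_n` — the multiplier data and
# the Leibniz left-hand sides of `slicePair_bgmFat_le` are `O(step²/Λ²)` (axes, normal) resp. `O(step²·N_r²)` (tangent), with explicit constants

Cell `gate-hubbard-kl`, seat hubbard-kl-k3c2-p3; gen-4 ENGINE child stmt-HubbardSuperconductivity-19855 (`stub_engine_step_norms`, `α_n`).  In the
engine instance `Λ_m = 4Λ` (fat radial scale one above the slice), `N_r = 2^{m+1}` with `N_r²Λ = e₀`, `w_{m+1} = π/N_r`, `ρ_f ≤ c_ρ·π/N_r`,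
`1 + 2/w ≤ 2N_r`, `N_rΛ ≤ e₀/2`; the steps are `ℓ₁ = 2π/L` (axes) and `ℓ = (2π/L)(N_r + ½)` (normal/tangent) with `ℓ ≤ 1`, `ℓ·N_r ≤ 1`.
Under these purely numerical hypotheses this file bounds the abbreviations `Ae1, Ae2, An1, An2, Av1, Av2` of `slicePair_bgmFat_le` and the four
Leibniz quantities `Q_t, Q_e, Q_n, Q_v` by closed forms: `Q_t = A₀(π/β)²D_t/Λ²`, `Q_e ≤ A₀ℓ₁²q_e/Λ²`, `Q_n ≤ A₀ℓ²q_e/Λ²`, `Q_v ≤ A₀ℓ²N_r²q_v`.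
Pure real algebra; no definitions. [folklore]
-/

noncomputable section

namespace Summit.HubbardSuperconductivity.HubbardSuperconductivity.Theorems.TorusFourierL2

set_option linter.dupNamespace false -- summit = problem name (single-conjunct summit), D-0017

/-! ### §1 Time: exact closed form -/

/-- **Time rate, closed form**: with `Λ_m = 4Λ`, the time Leibniz quantity is `A₀·((π/β)²·D_t/Λ²)`, `D_t = C₂ + G₁C₁ + G₂ + G₁/2`,
`A₀ = c₀·4c/Λ`. [folklore] -/
theorem timeLeibniz_eq {c₀ c C₁ C₂ G₁ G₂ β Λ Λm : ℝ} (hβ : 0 < β) (hΛ : 0 < Λ) (hΛm : Λm = 4 * Λ) :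
    c₀ * (1 * ((2 * Real.pi / β) ^ 2 * (C₂ * c / Λ ^ 3)) + 2 * ((2 * G₁ * |2 * Real.pi / β| * 1 / Λm) * ((2 * Real.pi / β) * (C₁ * c / Λ ^ 2))) +
        ((4 * G₂ + 2 * G₁) * (2 * Real.pi / β) ^ 2 * 1 / Λm ^ 2) * (4 * c / Λ)) =
      c₀ * (4 * c / Λ) * ((Real.pi / β) ^ 2 * (C₂ + G₁ * C₁ + G₂ + G₁ / 2) / Λ ^ 2) := by
  rw [abs_of_pos (by positivity : (0 : ℝ) < 2 * Real.pi / β), hΛm]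
  field_simp
  ring

/-! ### §2 Axes and normal direction: `O(t²/Λ²)` with the step `t ≤ 1` and the trivial tangency `(4+2A)t` -/

/-- **First-difference datum along a step of size `t`** (axes: `t = ℓ₁`; normal: `t = ℓ`): with `Λ_m = 4Λ`, `ρ_f ≤ c_ρπ/N_r ≤ c_ρπ`,
`1 + 2w⁻¹ ≤ 2N_r`, `N_rΛ ≤ e₀/2`, `t ≤ 1`:  `A1(t) ≤ t·(G₁(4+2A+Kp(c_ρπ+2))/2 + 72·Ba·e₀)/Λ`. [folklore] -/
theorem fatA1_step_le {G₁ A Kp ρf Λ Λm Ba wsi t cρ Nr e₀ : ℝ} (hG₁ : 0 ≤ G₁) (hKp : 0 ≤ Kp) (hΛ : 0 < Λ)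
    (hΛm : Λm = 4 * Λ) (hBa : 0 ≤ Ba) (ht0 : 0 ≤ t) (ht1 : t ≤ 1) (hcρ : 0 ≤ cρ) (hNr : 1 ≤ Nr)
    (hρfb : ρf ≤ cρ * Real.pi / Nr) (hws : 1 + 2 * wsi ≤ 2 * Nr) (hNrΛ : Nr * Λ ≤ e₀ / 2) :
    2 * G₁ * ((4 + 2 * A) * t + Kp * (ρf + 2 * t) * t) / Λm * 1 + 1 * 1 * (9 * (4 * Ba * ((1 + 2 * wsi) * (2 * t)))) ≤
      t * (G₁ * (4 + 2 * A + Kp * (cρ * Real.pi + 2)) / 2 + 72 * Ba * e₀) / Λ := by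
  have hπ := Real.pi_pos
  have hρf' : ρf ≤ cρ * Real.pi := by
    refine hρfb.trans (div_le_self (by positivity) hNr)
  -- first term
  have h1 : (4 + 2 * A) * t + Kp * (ρf + 2 * t) * t ≤ t * (4 + 2 * A + Kp * (cρ * Real.pi + 2)) := by
    have : Kp * (ρf + 2 * t) * t ≤ Kp * (cρ * Real.pi + 2) * t := by
      have : ρf + 2 * t ≤ cρ * Real.pi + 2 := by linarith
      exact mul_le_mul_of_nonneg_right (mul_le_mul_of_nonneg_left this hKp) ht0
    linarith
  have hA1 : 2 * G₁ * ((4 + 2 * A) * t + Kp * (ρf + 2 * t) * t) / Λm * 1 ≤ t * (G₁ * (4 + 2 * A + Kp * (cρ * Real.pi + 2)) / 2) / Λ := by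
    rw [hΛm, mul_one]
    rw [div_le_div_iff₀ (by positivity) hΛ]
    have := mul_le_mul_of_nonneg_left h1 (by positivity : (0 : ℝ) ≤ 2 * G₁)
    nlinarith [hΛ]
  -- second term: `(1 + 2wsi)·2t ≤ 4 Nr t` and `Nr ≤ e₀/(2Λ)`
  have hNr' : Nr ≤ e₀ / 2 / Λ := by rw [le_div_iff₀ hΛ]; exact hNrΛ
  have hA2 : 1 * 1 * (9 * (4 * Ba * ((1 + 2 * wsi) * (2 * t)))) ≤ t * (72 * Ba * e₀) / Λ := by
    have h2 : (1 + 2 * wsi) * (2 * t) ≤ 2 * Nr * (2 * t) := mul_le_mul_of_nonneg_right hws (by positivity)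
    have h3 : 2 * Nr * (2 * t) ≤ 2 * (e₀ / 2 / Λ) * (2 * t) := by
      exact mul_le_mul_of_nonneg_right (mul_le_mul_of_nonneg_left hNr' (by norm_num)) (by positivity)
    have h4 : 1 * 1 * (9 * (4 * Ba * ((1 + 2 * wsi) * (2 * t)))) ≤ 9 * (4 * Ba * (2 * (e₀ / 2 / Λ) * (2 * t))) := by
      rw [one_mul, one_mul]; exact mul_le_mul_of_nonneg_left (mul_le_mul_of_nonneg_left (h2.trans h3) (by positivity)) (by norm_num)
    refine h4.trans (le_of_eq ?_)
    field_simp; ring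
  have e : t * (G₁ * (4 + 2 * A + Kp * (cρ * Real.pi + 2)) / 2 + 72 * Ba * e₀) / Λ =
      t * (G₁ * (4 + 2 * A + Kp * (cρ * Real.pi + 2)) / 2) / Λ + t * (72 * Ba * e₀) / Λ := by ring
  rw [e]; exact add_le_add hA1 hA2

/-- **Second-difference datum along a step of size `t`**: with the same hypotheses,
`A2(t) ≤ t²·((4G₂+2G₁)b₁²/16 + G₁·Kp·e₀/2 + 144·G₁b₁·Ba·e₀ + 36(4Ba+8Ba²)e₀²)/Λ²`, `b₁ = 4+2A+Kp(c_ρπ+2)`. [folklore] -/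
theorem fatA2_step_le {G₁ G₂ A Kp ρf Λ Λm Ba wsi t cρ Nr e₀ : ℝ} (hG₁ : 0 ≤ G₁) (hG₂ : 0 ≤ G₂) (hA : 0 ≤ A) (hKp : 0 ≤ Kp) (hρf : 0 ≤ ρf)
    (hΛ : 0 < Λ) (hΛm : Λm = 4 * Λ) (hBa : 0 ≤ Ba) (hwsi : 0 ≤ wsi) (ht0 : 0 ≤ t) (ht1 : t ≤ 1) (hcρ : 0 ≤ cρ) (hNr : 1 ≤ Nr)
    (hρfb : ρf ≤ cρ * Real.pi / Nr) (hws : 1 + 2 * wsi ≤ 2 * Nr) (hNrΛ : Nr * Λ ≤ e₀ / 2) (hΛe : Λ ≤ e₀) :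
    ((4 * G₂ + 2 * G₁) * ((4 + 2 * A) * t + Kp * (ρf + 2 * t) * t) ^ 2 / Λm ^ 2 + 2 * G₁ * (Kp * t ^ 2) / Λm) * 1 +
        4 * G₁ * ((4 + 2 * A) * t + Kp * (ρf + 2 * t) * t) / Λm * (9 * (4 * Ba * ((1 + 2 * wsi) * (2 * t)))) +
        1 * 1 * (9 * (4 * Ba * ((1 + 2 * wsi) * (2 * t)) ^ 2 + 8 * Ba ^ 2 * ((1 + 2 * wsi) * (2 * t)) ^ 2)) ≤
      t ^ 2 * ((4 * G₂ + 2 * G₁) * (4 + 2 * A + Kp * (cρ * Real.pi + 2)) ^ 2 / 16 + G₁ * Kp * e₀ / 2 +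
        144 * G₁ * (4 + 2 * A + Kp * (cρ * Real.pi + 2)) * Ba * e₀ + 36 * (4 * Ba + 8 * Ba ^ 2) * e₀ ^ 2) / Λ ^ 2 := by
  have hπ := Real.pi_pos
  have he₀ : 0 < e₀ := lt_of_lt_of_le hΛ hΛe
  set b₁ : ℝ := 4 + 2 * A + Kp * (cρ * Real.pi + 2) with hb₁
  have hb₁0 : 0 ≤ b₁ := by rw [hb₁]; positivity
  have hρf' : ρf ≤ cρ * Real.pi := hρfb.trans (div_le_self (by positivity) hNr)
  have hτ : (4 + 2 * A) * t + Kp * (ρf + 2 * t) * t ≤ t * b₁ := by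
    have : Kp * (ρf + 2 * t) * t ≤ Kp * (cρ * Real.pi + 2) * t := by
      have : ρf + 2 * t ≤ cρ * Real.pi + 2 := by linarith
      exact mul_le_mul_of_nonneg_right (mul_le_mul_of_nonneg_left this hKp) ht0
    rw [hb₁]; linarith
  have hτ0 : 0 ≤ (4 + 2 * A) * t + Kp * (ρf + 2 * t) * t := by positivity
  have hNr' : Nr ≤ e₀ / 2 / Λ := by rw [le_div_iff₀ hΛ]; exact hNrΛ
  have hzz : (1 + 2 * wsi) * (2 * t) ≤ 2 * (e₀ / Λ) * t := by
    have h2 : (1 + 2 * wsi) * (2 * t) ≤ 2 * Nr * (2 * t) := mul_le_mul_of_nonneg_right hws (by positivity)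
    have h3 : 2 * Nr * (2 * t) ≤ 2 * (e₀ / 2 / Λ) * (2 * t) :=
      mul_le_mul_of_nonneg_right (mul_le_mul_of_nonneg_left hNr' (by norm_num)) (by positivity)
    refine (h2.trans h3).trans (le_of_eq ?_); field_simp
  have hzz0 : 0 ≤ (1 + 2 * wsi) * (2 * t) := by positivity
  have hinvΛ : 1 / Λ ≤ e₀ / Λ ^ 2 := by
    rw [div_le_div_iff₀ hΛ (by positivity)]; nlinarith
  -- term by term
  have T1 : (4 * G₂ + 2 * G₁) * ((4 + 2 * A) * t + Kp * (ρf + 2 * t) * t) ^ 2 / Λm ^ 2 ≤ t ^ 2 * ((4 * G₂ + 2 * G₁) * b₁ ^ 2 / 16) / Λ ^ 2 := by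
    have hsq : ((4 + 2 * A) * t + Kp * (ρf + 2 * t) * t) ^ 2 ≤ (t * b₁) ^ 2 := pow_le_pow_left₀ hτ0 hτ 2
    rw [hΛm]
    calc (4 * G₂ + 2 * G₁) * ((4 + 2 * A) * t + Kp * (ρf + 2 * t) * t) ^ 2 / (4 * Λ) ^ 2
        ≤ (4 * G₂ + 2 * G₁) * (t * b₁) ^ 2 / (4 * Λ) ^ 2 := by gcongr
      _ = t ^ 2 * ((4 * G₂ + 2 * G₁) * b₁ ^ 2 / 16) / Λ ^ 2 := by field_simp; ring
  have T2 : 2 * G₁ * (Kp * t ^ 2) / Λm ≤ t ^ 2 * (G₁ * Kp * e₀ / 2) / Λ ^ 2 := by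
    rw [hΛm]
    have : 2 * G₁ * (Kp * t ^ 2) / (4 * Λ) = (G₁ * Kp * t ^ 2 / 2) * (1 / Λ) := by field_simp; ring
    rw [this]
    calc G₁ * Kp * t ^ 2 / 2 * (1 / Λ) ≤ G₁ * Kp * t ^ 2 / 2 * (e₀ / Λ ^ 2) := mul_le_mul_of_nonneg_left hinvΛ (by positivity)
      _ = t ^ 2 * (G₁ * Kp * e₀ / 2) / Λ ^ 2 := by field_simp
  have T3 : 4 * G₁ * ((4 + 2 * A) * t + Kp * (ρf + 2 * t) * t) / Λm * (9 * (4 * Ba * ((1 + 2 * wsi) * (2 * t)))) ≤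
      t ^ 2 * (144 * G₁ * b₁ * Ba * e₀) / Λ ^ 2 := by
    rw [hΛm]
    have h1 : 4 * G₁ * ((4 + 2 * A) * t + Kp * (ρf + 2 * t) * t) / (4 * Λ) ≤ 4 * G₁ * (t * b₁) / (4 * Λ) := by gcongr
    have h10 : 0 ≤ 4 * G₁ * (t * b₁) / (4 * Λ) := by positivity
    have h2 : 9 * (4 * Ba * ((1 + 2 * wsi) * (2 * t))) ≤ 9 * (4 * Ba * (2 * (e₀ / Λ) * t)) := by gcongr
    have h20 : 0 ≤ 9 * (4 * Ba * ((1 + 2 * wsi) * (2 * t))) := by positivity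
    calc _ ≤ 4 * G₁ * (t * b₁) / (4 * Λ) * (9 * (4 * Ba * (2 * (e₀ / Λ) * t))) := mul_le_mul h1 h2 h20 h10
      _ = t ^ 2 * (72 * G₁ * b₁ * Ba * e₀) / Λ ^ 2 := by field_simp; ring
      _ ≤ t ^ 2 * (144 * G₁ * b₁ * Ba * e₀) / Λ ^ 2 := by gcongr; linarith [show 0 ≤ G₁ * b₁ * Ba * e₀ by positivity]
  have T4 : 1 * 1 * (9 * (4 * Ba * ((1 + 2 * wsi) * (2 * t)) ^ 2 + 8 * Ba ^ 2 * ((1 + 2 * wsi) * (2 * t)) ^ 2)) ≤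
      t ^ 2 * (36 * (4 * Ba + 8 * Ba ^ 2) * e₀ ^ 2) / Λ ^ 2 := by
    have hsq : ((1 + 2 * wsi) * (2 * t)) ^ 2 ≤ (2 * (e₀ / Λ) * t) ^ 2 := pow_le_pow_left₀ hzz0 hzz 2
    rw [one_mul, one_mul]
    calc 9 * (4 * Ba * ((1 + 2 * wsi) * (2 * t)) ^ 2 + 8 * Ba ^ 2 * ((1 + 2 * wsi) * (2 * t)) ^ 2)
        ≤ 9 * (4 * Ba * (2 * (e₀ / Λ) * t) ^ 2 + 8 * Ba ^ 2 * (2 * (e₀ / Λ) * t) ^ 2) := by gcongr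
      _ = t ^ 2 * (36 * (4 * Ba + 8 * Ba ^ 2) * e₀ ^ 2) / Λ ^ 2 := by field_simp; ring
  have e : t ^ 2 * ((4 * G₂ + 2 * G₁) * b₁ ^ 2 / 16 + G₁ * Kp * e₀ / 2 + 144 * G₁ * b₁ * Ba * e₀ + 36 * (4 * Ba + 8 * Ba ^ 2) * e₀ ^ 2) / Λ ^ 2 =
      t ^ 2 * ((4 * G₂ + 2 * G₁) * b₁ ^ 2 / 16) / Λ ^ 2 + t ^ 2 * (G₁ * Kp * e₀ / 2) / Λ ^ 2 +
        t ^ 2 * (144 * G₁ * b₁ * Ba * e₀) / Λ ^ 2 + t ^ 2 * (36 * (4 * Ba + 8 * Ba ^ 2) * e₀ ^ 2) / Λ ^ 2 := by ring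
  rw [e]
  linarith [T1, T2, T3, T4]

/-- **The Leibniz quantity of a space direction with trivial tangency** (axes `t = ℓ₁`, normal `t = ℓ`): if `a₁ ≤ t·ā₁/Λ`, `a₂ ≤ t²·ā₂/Λ²`,
`ne = √2·t`, `t ≤ 1`, `Λ ≤ e₀`, then
`Q ≤ A₀·t²·(C₂(√2K₁+8K₂)²/4 + C₁K₂e₀/2 + ā₁C₁(√2K₁+6K₂)/2 + ā₂)/Λ²`, `A₀ = c₀·4c/Λ`. [folklore] -/
theorem spaceLeibniz_le {c₀ c C₁ C₂ K₁ K₂ Λ e₀ t a₁ a₂ ab₁ ab₂ : ℝ} (hc₀ : 0 ≤ c₀) (hc : 0 ≤ c) (hC₁ : 0 ≤ C₁) (hC₂ : 0 ≤ C₂)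
    (hK₁ : 0 ≤ K₁) (hK₂ : 0 ≤ K₂) (hΛ : 0 < Λ) (hΛe : Λ ≤ e₀) (ht0 : 0 ≤ t) (ht1 : t ≤ 1) (hab₁ : 0 ≤ ab₁)
    (ha₁ : a₁ ≤ t * ab₁ / Λ) (ha₂ : a₂ ≤ t ^ 2 * ab₂ / Λ ^ 2) :
    c₀ * (1 * (C₂ * c / Λ ^ 3 * (K₁ * (Real.sqrt 2 * t) + 4 * (K₂ * (Real.sqrt 2 * t) ^ 2)) ^ 2 + C₁ * c / Λ ^ 2 * (K₂ * (Real.sqrt 2 * t) ^ 2)) +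
        2 * (a₁ * (C₁ * c / Λ ^ 2 * (K₁ * (Real.sqrt 2 * t) + 3 * (K₂ * (Real.sqrt 2 * t) ^ 2)))) + a₂ * (4 * c / Λ)) ≤
      c₀ * (4 * c / Λ) * (t ^ 2 * (C₂ * (Real.sqrt 2 * K₁ + 8 * K₂) ^ 2 / 4 + C₁ * K₂ * e₀ / 2 +
        ab₁ * C₁ * (Real.sqrt 2 * K₁ + 6 * K₂) / 2 + ab₂) / Λ ^ 2) := by
  have hs2 : Real.sqrt 2 ^ 2 = 2 := Real.sq_sqrt (by norm_num)
  have hs0 : 0 ≤ Real.sqrt 2 := Real.sqrt_nonneg 2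
  have he₀ : 0 < e₀ := lt_of_lt_of_le hΛ hΛe
  -- the inner quantities are `≤ t·(…)`
  have ht2 : t ^ 2 ≤ t := by nlinarith
  have hKt : K₂ * t ^ 2 ≤ K₂ * t := mul_le_mul_of_nonneg_left ht2 hK₂
  have hst : (Real.sqrt 2 * t) ^ 2 = 2 * t ^ 2 := by rw [mul_pow, hs2]
  have h1 : K₁ * (Real.sqrt 2 * t) + 4 * (K₂ * (Real.sqrt 2 * t) ^ 2) ≤ t * (Real.sqrt 2 * K₁ + 8 * K₂) := by
    rw [hst]
    have e : t * (Real.sqrt 2 * K₁ + 8 * K₂) = K₁ * (Real.sqrt 2 * t) + 8 * (K₂ * t) := by ring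
    rw [e]; nlinarith [hKt]
  have h10 : 0 ≤ K₁ * (Real.sqrt 2 * t) + 4 * (K₂ * (Real.sqrt 2 * t) ^ 2) := by positivity
  have h2 : K₂ * (Real.sqrt 2 * t) ^ 2 ≤ t ^ 2 * (2 * K₂) := by rw [hst]; nlinarith
  have h3 : K₁ * (Real.sqrt 2 * t) + 3 * (K₂ * (Real.sqrt 2 * t) ^ 2) ≤ t * (Real.sqrt 2 * K₁ + 6 * K₂) := by
    rw [hst]
    have e : t * (Real.sqrt 2 * K₁ + 6 * K₂) = K₁ * (Real.sqrt 2 * t) + 6 * (K₂ * t) := by ring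
    rw [e]; nlinarith [hKt]
  have h30 : 0 ≤ K₁ * (Real.sqrt 2 * t) + 3 * (K₂ * (Real.sqrt 2 * t) ^ 2) := by positivity
  -- divide by `c₀ c` and compare term by term
  have hinvΛ : 1 / Λ ≤ e₀ / Λ ^ 2 := by rw [div_le_div_iff₀ hΛ (by positivity)]; nlinarith
  have T1 : C₂ * c / Λ ^ 3 * (K₁ * (Real.sqrt 2 * t) + 4 * (K₂ * (Real.sqrt 2 * t) ^ 2)) ^ 2 ≤
      4 * c / Λ * (t ^ 2 * (C₂ * (Real.sqrt 2 * K₁ + 8 * K₂) ^ 2 / 4) / Λ ^ 2) := by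
    calc _ ≤ C₂ * c / Λ ^ 3 * (t * (Real.sqrt 2 * K₁ + 8 * K₂)) ^ 2 := by gcongr
      _ = 4 * c / Λ * (t ^ 2 * (C₂ * (Real.sqrt 2 * K₁ + 8 * K₂) ^ 2 / 4) / Λ ^ 2) := by field_simp
  have T2 : C₁ * c / Λ ^ 2 * (K₂ * (Real.sqrt 2 * t) ^ 2) ≤ 4 * c / Λ * (t ^ 2 * (C₁ * K₂ * e₀ / 2) / Λ ^ 2) := by
    calc _ ≤ C₁ * c / Λ ^ 2 * (t ^ 2 * (2 * K₂)) := by gcongr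
      _ = (2 * C₁ * c * K₂ * t ^ 2 / Λ) * (1 / Λ) := by field_simp
      _ ≤ (2 * C₁ * c * K₂ * t ^ 2 / Λ) * (e₀ / Λ ^ 2) := mul_le_mul_of_nonneg_left hinvΛ (by positivity)
      _ = 4 * c / Λ * (t ^ 2 * (C₁ * K₂ * e₀ / 2) / Λ ^ 2) := by field_simp; ring
  have T3 : 2 * (a₁ * (C₁ * c / Λ ^ 2 * (K₁ * (Real.sqrt 2 * t) + 3 * (K₂ * (Real.sqrt 2 * t) ^ 2)))) ≤
      4 * c / Λ * (t ^ 2 * (ab₁ * C₁ * (Real.sqrt 2 * K₁ + 6 * K₂) / 2) / Λ ^ 2) := by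
    have h := mul_le_mul ha₁ (mul_le_mul_of_nonneg_left h3 (by positivity : 0 ≤ C₁ * c / Λ ^ 2)) (by positivity) (by positivity)
    calc _ ≤ 2 * (t * ab₁ / Λ * (C₁ * c / Λ ^ 2 * (t * (Real.sqrt 2 * K₁ + 6 * K₂)))) := by linarith
      _ = 4 * c / Λ * (t ^ 2 * (ab₁ * C₁ * (Real.sqrt 2 * K₁ + 6 * K₂) / 2) / Λ ^ 2) := by field_simp; ring
  have T4 : a₂ * (4 * c / Λ) ≤ 4 * c / Λ * (t ^ 2 * ab₂ / Λ ^ 2) := by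
    rw [mul_comm]; exact mul_le_mul_of_nonneg_left ha₂ (by positivity)
  have e : c₀ * (4 * c / Λ) * (t ^ 2 * (C₂ * (Real.sqrt 2 * K₁ + 8 * K₂) ^ 2 / 4 + C₁ * K₂ * e₀ / 2 +
        ab₁ * C₁ * (Real.sqrt 2 * K₁ + 6 * K₂) / 2 + ab₂) / Λ ^ 2) =
      c₀ * (4 * c / Λ * (t ^ 2 * (C₂ * (Real.sqrt 2 * K₁ + 8 * K₂) ^ 2 / 4) / Λ ^ 2) + 4 * c / Λ * (t ^ 2 * (C₁ * K₂ * e₀ / 2) / Λ ^ 2) +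
        4 * c / Λ * (t ^ 2 * (ab₁ * C₁ * (Real.sqrt 2 * K₁ + 6 * K₂) / 2) / Λ ^ 2) + 4 * c / Λ * (t ^ 2 * ab₂ / Λ ^ 2)) := by ring
  rw [e]
  refine mul_le_mul_of_nonneg_left ?_ hc₀
  linarith [T1, T2, T3, T4]

/-! ### §3 Tangent direction: `O(ℓ²N_r²)` — the anisotropic gain `τ ≲ ℓ/N_r` against `N_r²Λ = e₀` -/

/-- The tangential datum of the fat pair along the tangent step: `τ₀ + Kp(ρ_f + 2ℓ)ℓ ≤ (ℓ/N_r)·(4+2A+Kp(c_ρπ+2))` when `τ₀ = ℓ₁(4+2A)`,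
`ℓ₁ ≤ ℓ/N_r`, `ρ_f ≤ c_ρπ/N_r`, `ℓN_r ≤ 1`. [folklore] -/
theorem tangentDatum_le {A Kp ρf ℓ l1 cρ Nr : ℝ} (hA : 0 ≤ A) (hKp : 0 ≤ Kp) (hℓ : 0 ≤ ℓ) (hNr : 1 ≤ Nr)
    (hl1 : l1 ≤ ℓ / Nr) (hρfb : ρf ≤ cρ * Real.pi / Nr) (hℓNr : ℓ * Nr ≤ 1) :
    l1 * (4 + 2 * A) + Kp * (ρf + 2 * ℓ) * ℓ ≤ ℓ / Nr * (4 + 2 * A + Kp * (cρ * Real.pi + 2)) := by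
  have hNr0 : 0 < Nr := by linarith
  have hℓ' : ℓ ≤ 1 / Nr := by rw [le_div_iff₀ hNr0]; exact hℓNr
  have h1 : l1 * (4 + 2 * A) ≤ ℓ / Nr * (4 + 2 * A) := mul_le_mul_of_nonneg_right hl1 (by positivity)
  have h2 : ρf + 2 * ℓ ≤ (cρ * Real.pi + 2) / Nr := by
    rw [add_div]; refine add_le_add hρfb ?_
    rw [le_div_iff₀ hNr0]; nlinarith
  have h3 : Kp * (ρf + 2 * ℓ) * ℓ ≤ Kp * ((cρ * Real.pi + 2) / Nr) * ℓ :=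
    mul_le_mul_of_nonneg_right (mul_le_mul_of_nonneg_left h2 hKp) hℓ
  have e : ℓ / Nr * (4 + 2 * A + Kp * (cρ * Real.pi + 2)) = ℓ / Nr * (4 + 2 * A) + Kp * ((cρ * Real.pi + 2) / Nr) * ℓ := by
    field_simp
  rw [e]; exact add_le_add h1 h3

/-- **First-difference datum along the tangent step**: `Av1 ≤ ℓN_r·(G₁b₁/(2e₀) + 288·Ba)`, `b₁ = 4+2A+Kp(c_ρπ+2)`. [folklore] -/
theorem fatA1_tangent_le {G₁ A Kp ρf Λ Λm Ba wsi ℓ l1 cρ Nr e₀ : ℝ} (hG₁ : 0 ≤ G₁) (hA : 0 ≤ A) (hKp : 0 ≤ Kp) (hΛ : 0 < Λ)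
    (hΛm : Λm = 4 * Λ) (hBa : 0 ≤ Ba) (hℓ : 0 ≤ ℓ) (hNr : 1 ≤ Nr) (hl1 : l1 ≤ ℓ / Nr)
    (hρfb : ρf ≤ cρ * Real.pi / Nr) (hℓNr : ℓ * Nr ≤ 1) (hws : 1 + 2 * wsi ≤ 2 * Nr) (hNrΛ : Nr ^ 2 * Λ = e₀) :
    2 * G₁ * (l1 * (4 + 2 * A) + Kp * (ρf + 2 * ℓ) * ℓ) / Λm * 1 + 1 * 1 * (9 * (4 * Ba * ((1 + 2 * wsi) * (2 * ℓ)))) ≤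
      ℓ * Nr * (G₁ * (4 + 2 * A + Kp * (cρ * Real.pi + 2)) / (2 * e₀) + 288 * Ba) := by
  have hNr0 : 0 < Nr := by linarith
  have he₀ : 0 < e₀ := by rw [← hNrΛ]; positivity
  set b₁ : ℝ := 4 + 2 * A + Kp * (cρ * Real.pi + 2) with hb₁
  have hτ := tangentDatum_le hA hKp hℓ hNr hl1 hρfb hℓNr
  have hA1 : 2 * G₁ * (l1 * (4 + 2 * A) + Kp * (ρf + 2 * ℓ) * ℓ) / Λm * 1 ≤ ℓ * Nr * (G₁ * b₁ / (2 * e₀)) := by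
    rw [hΛm, mul_one]
    calc 2 * G₁ * (l1 * (4 + 2 * A) + Kp * (ρf + 2 * ℓ) * ℓ) / (4 * Λ) ≤ 2 * G₁ * (ℓ / Nr * b₁) / (4 * Λ) := by gcongr
      _ = ℓ * Nr * (G₁ * b₁ / (2 * e₀)) := by rw [← hNrΛ]; field_simp; ring
  have hA2 : 1 * 1 * (9 * (4 * Ba * ((1 + 2 * wsi) * (2 * ℓ)))) ≤ ℓ * Nr * (288 * Ba) := by
    have h2 : (1 + 2 * wsi) * (2 * ℓ) ≤ 2 * Nr * (2 * ℓ) := mul_le_mul_of_nonneg_right hws (by positivity)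
    rw [one_mul, one_mul]
    calc 9 * (4 * Ba * ((1 + 2 * wsi) * (2 * ℓ))) ≤ 9 * (4 * Ba * (2 * Nr * (2 * ℓ))) := by gcongr
      _ = ℓ * Nr * (144 * Ba) := by ring
      _ ≤ ℓ * Nr * (288 * Ba) := by gcongr; linarith
  have e : ℓ * Nr * (G₁ * b₁ / (2 * e₀) + 288 * Ba) = ℓ * Nr * (G₁ * b₁ / (2 * e₀)) + ℓ * Nr * (288 * Ba) := by ring
  rw [e]; exact add_le_add hA1 hA2

/-- **Second-difference datum along the tangent step**: `Av2 ≤ ℓ²N_r²·av2`,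
`av2 = (4G₂+2G₁)b₁²/(16e₀²) + G₁Kp/(2e₀) + 144·G₁b₁Ba/e₀ + 144(4Ba+8Ba²)`. [folklore] -/
theorem fatA2_tangent_le {G₁ G₂ A Kp ρf Λ Λm Ba wsi ℓ l1 cρ Nr e₀ : ℝ} (hG₁ : 0 ≤ G₁) (hG₂ : 0 ≤ G₂) (hA : 0 ≤ A) (hKp : 0 ≤ Kp)
    (hρf : 0 ≤ ρf) (hΛ : 0 < Λ) (hΛm : Λm = 4 * Λ) (hBa : 0 ≤ Ba) (hℓ : 0 ≤ ℓ) (hl10 : 0 ≤ l1) (hNr : 1 ≤ Nr) (hl1 : l1 ≤ ℓ / Nr)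
    (hρfb : ρf ≤ cρ * Real.pi / Nr) (hℓNr : ℓ * Nr ≤ 1) (hws : 1 + 2 * wsi ≤ 2 * Nr) (hwsi : 0 ≤ wsi) (hNrΛ : Nr ^ 2 * Λ = e₀) :
    ((4 * G₂ + 2 * G₁) * (l1 * (4 + 2 * A) + Kp * (ρf + 2 * ℓ) * ℓ) ^ 2 / Λm ^ 2 + 2 * G₁ * (Kp * ℓ ^ 2) / Λm) * 1 +
        4 * G₁ * (l1 * (4 + 2 * A) + Kp * (ρf + 2 * ℓ) * ℓ) / Λm * (9 * (4 * Ba * ((1 + 2 * wsi) * (2 * ℓ)))) +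
        1 * 1 * (9 * (4 * Ba * ((1 + 2 * wsi) * (2 * ℓ)) ^ 2 + 8 * Ba ^ 2 * ((1 + 2 * wsi) * (2 * ℓ)) ^ 2)) ≤
      ℓ ^ 2 * Nr ^ 2 * ((4 * G₂ + 2 * G₁) * (4 + 2 * A + Kp * (cρ * Real.pi + 2)) ^ 2 / (16 * e₀ ^ 2) + G₁ * Kp / (2 * e₀) +
        144 * G₁ * (4 + 2 * A + Kp * (cρ * Real.pi + 2)) * Ba / e₀ + 144 * (4 * Ba + 8 * Ba ^ 2)) := by
  have hNr0 : 0 < Nr := by linarith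
  have he₀ : 0 < e₀ := by rw [← hNrΛ]; positivity
  have hcρ : 0 ≤ cρ * Real.pi / Nr := le_trans hρf hρfb
  set b₁ : ℝ := 4 + 2 * A + Kp * (cρ * Real.pi + 2) with hb₁
  have hb₁0 : 0 ≤ b₁ := by
    have : 0 ≤ cρ * Real.pi := by
      have := mul_nonneg hcρ hNr0.le; rwa [div_mul_cancel₀ _ hNr0.ne'] at this
    rw [hb₁]; positivity
  have hτ := tangentDatum_le hA hKp hℓ hNr hl1 hρfb hℓNr
  have hτ0 : 0 ≤ l1 * (4 + 2 * A) + Kp * (ρf + 2 * ℓ) * ℓ := by positivity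
  have hz : (1 + 2 * wsi) * (2 * ℓ) ≤ 4 * Nr * ℓ := by
    have := mul_le_mul_of_nonneg_right hws (by positivity : 0 ≤ 2 * ℓ); linarith
  have hz0 : 0 ≤ (1 + 2 * wsi) * (2 * ℓ) := by positivity
  have hΛinv : 1 / Λ = Nr ^ 2 / e₀ := by rw [← hNrΛ]; field_simp
  have T1 : (4 * G₂ + 2 * G₁) * (l1 * (4 + 2 * A) + Kp * (ρf + 2 * ℓ) * ℓ) ^ 2 / Λm ^ 2 ≤
      ℓ ^ 2 * Nr ^ 2 * ((4 * G₂ + 2 * G₁) * b₁ ^ 2 / (16 * e₀ ^ 2)) := by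
    rw [hΛm]
    calc _ ≤ (4 * G₂ + 2 * G₁) * (ℓ / Nr * b₁) ^ 2 / (4 * Λ) ^ 2 := by gcongr
      _ = ℓ ^ 2 * Nr ^ 2 * ((4 * G₂ + 2 * G₁) * b₁ ^ 2 / (16 * e₀ ^ 2)) := by rw [← hNrΛ]; field_simp; ring
  have T2 : 2 * G₁ * (Kp * ℓ ^ 2) / Λm ≤ ℓ ^ 2 * Nr ^ 2 * (G₁ * Kp / (2 * e₀)) := by
    rw [hΛm]; refine le_of_eq ?_; rw [← hNrΛ]; field_simp; ring
  have T3 : 4 * G₁ * (l1 * (4 + 2 * A) + Kp * (ρf + 2 * ℓ) * ℓ) / Λm * (9 * (4 * Ba * ((1 + 2 * wsi) * (2 * ℓ)))) ≤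
      ℓ ^ 2 * Nr ^ 2 * (144 * G₁ * b₁ * Ba / e₀) := by
    rw [hΛm]
    have h1 : 4 * G₁ * (l1 * (4 + 2 * A) + Kp * (ρf + 2 * ℓ) * ℓ) / (4 * Λ) ≤ 4 * G₁ * (ℓ / Nr * b₁) / (4 * Λ) := by gcongr
    have h10 : 0 ≤ 4 * G₁ * (ℓ / Nr * b₁) / (4 * Λ) := by positivity
    have h2 : 9 * (4 * Ba * ((1 + 2 * wsi) * (2 * ℓ))) ≤ 9 * (4 * Ba * (4 * Nr * ℓ)) := by gcongr
    have h20 : 0 ≤ 9 * (4 * Ba * ((1 + 2 * wsi) * (2 * ℓ))) := by positivity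
    calc _ ≤ 4 * G₁ * (ℓ / Nr * b₁) / (4 * Λ) * (9 * (4 * Ba * (4 * Nr * ℓ))) := mul_le_mul h1 h2 h20 h10
      _ = ℓ ^ 2 * Nr ^ 2 * (144 * G₁ * b₁ * Ba / e₀) := by rw [← hNrΛ]; field_simp; ring
  have T4 : 1 * 1 * (9 * (4 * Ba * ((1 + 2 * wsi) * (2 * ℓ)) ^ 2 + 8 * Ba ^ 2 * ((1 + 2 * wsi) * (2 * ℓ)) ^ 2)) ≤
      ℓ ^ 2 * Nr ^ 2 * (144 * (4 * Ba + 8 * Ba ^ 2)) := by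
    have hsq : ((1 + 2 * wsi) * (2 * ℓ)) ^ 2 ≤ (4 * Nr * ℓ) ^ 2 := pow_le_pow_left₀ hz0 hz 2
    rw [one_mul, one_mul]
    calc 9 * (4 * Ba * ((1 + 2 * wsi) * (2 * ℓ)) ^ 2 + 8 * Ba ^ 2 * ((1 + 2 * wsi) * (2 * ℓ)) ^ 2)
        ≤ 9 * (4 * Ba * (4 * Nr * ℓ) ^ 2 + 8 * Ba ^ 2 * (4 * Nr * ℓ) ^ 2) := by gcongr
      _ = ℓ ^ 2 * Nr ^ 2 * (144 * (4 * Ba + 8 * Ba ^ 2)) := by ring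
  have e : ℓ ^ 2 * Nr ^ 2 * ((4 * G₂ + 2 * G₁) * b₁ ^ 2 / (16 * e₀ ^ 2) + G₁ * Kp / (2 * e₀) + 144 * G₁ * b₁ * Ba / e₀ + 144 * (4 * Ba + 8 * Ba ^ 2)) =
      ℓ ^ 2 * Nr ^ 2 * ((4 * G₂ + 2 * G₁) * b₁ ^ 2 / (16 * e₀ ^ 2)) + ℓ ^ 2 * Nr ^ 2 * (G₁ * Kp / (2 * e₀)) +
        ℓ ^ 2 * Nr ^ 2 * (144 * G₁ * b₁ * Ba / e₀) + ℓ ^ 2 * Nr ^ 2 * (144 * (4 * Ba + 8 * Ba ^ 2)) := by ring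
  rw [e]; linarith [T1, T2, T3, T4]

/-- **The Leibniz quantity of the tangent direction**: with `τt ≤ (ℓ/N_r)·b_τ`, `a₁ ≤ ℓN_r·ā₁`, `a₂ ≤ ℓ²N_r²·ā₂`, `ne = √2ℓ`, `ℓN_r ≤ 1`,
`N_r²Λ = e₀`: `Q_v ≤ A₀·ℓ²N_r²·(C₂(b_τ+8K₂)²/(4e₀²) + C₁K₂/(2e₀) + ā₁C₁(b_τ+6K₂)/(2e₀) + ā₂)`, `A₀ = c₀·4c/Λ`. [folklore] -/
theorem tangentLeibniz_le {c₀ c C₁ C₂ K₂ Λ e₀ ℓ Nr τt bτ a₁ a₂ ab₁ ab₂ : ℝ} (hc₀ : 0 ≤ c₀) (hc : 0 ≤ c) (hC₁ : 0 ≤ C₁) (hC₂ : 0 ≤ C₂)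
    (hK₂ : 0 ≤ K₂) (hΛ : 0 < Λ) (hℓ : 0 ≤ ℓ) (hNr : 1 ≤ Nr) (hℓNr : ℓ * Nr ≤ 1) (hNrΛ : Nr ^ 2 * Λ = e₀)
    (hτt0 : 0 ≤ τt) (hτt : τt ≤ ℓ / Nr * bτ) (hab₁ : 0 ≤ ab₁) (ha₁ : a₁ ≤ ℓ * Nr * ab₁)
    (ha₂ : a₂ ≤ ℓ ^ 2 * Nr ^ 2 * ab₂) :
    c₀ * (1 * (C₂ * c / Λ ^ 3 * (τt + 4 * (K₂ * (Real.sqrt 2 * ℓ) ^ 2)) ^ 2 + C₁ * c / Λ ^ 2 * (K₂ * (Real.sqrt 2 * ℓ) ^ 2)) +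
        2 * (a₁ * (C₁ * c / Λ ^ 2 * (τt + 3 * (K₂ * (Real.sqrt 2 * ℓ) ^ 2)))) + a₂ * (4 * c / Λ)) ≤
      c₀ * (4 * c / Λ) * (ℓ ^ 2 * Nr ^ 2 * (C₂ * (bτ + 8 * K₂) ^ 2 / (4 * e₀ ^ 2) + C₁ * K₂ / (2 * e₀) +
        ab₁ * C₁ * (bτ + 6 * K₂) / (2 * e₀) + ab₂)) := by
  have hNr0 : 0 < Nr := by linarith
  have he₀ : 0 < e₀ := by rw [← hNrΛ]; positivity
  have hs2 : Real.sqrt 2 ^ 2 = 2 := Real.sq_sqrt (by norm_num)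
  have hst : (Real.sqrt 2 * ℓ) ^ 2 = 2 * ℓ ^ 2 := by rw [mul_pow, hs2]
  have hℓ' : ℓ ≤ 1 / Nr := by rw [le_div_iff₀ hNr0]; exact hℓNr
  have hℓ2 : ℓ ^ 2 ≤ ℓ / Nr := by
    rw [pow_two, div_eq_mul_one_div]; exact mul_le_mul_of_nonneg_left hℓ' hℓ
  have h1 : τt + 4 * (K₂ * (Real.sqrt 2 * ℓ) ^ 2) ≤ ℓ / Nr * (bτ + 8 * K₂) := by
    rw [hst]
    have : 4 * (K₂ * (2 * ℓ ^ 2)) ≤ ℓ / Nr * (8 * K₂) := by nlinarith [mul_le_mul_of_nonneg_left hℓ2 hK₂]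
    nlinarith
  have h10 : 0 ≤ τt + 4 * (K₂ * (Real.sqrt 2 * ℓ) ^ 2) := by positivity
  have h3 : τt + 3 * (K₂ * (Real.sqrt 2 * ℓ) ^ 2) ≤ ℓ / Nr * (bτ + 6 * K₂) := by
    rw [hst]
    have : 3 * (K₂ * (2 * ℓ ^ 2)) ≤ ℓ / Nr * (6 * K₂) := by nlinarith [mul_le_mul_of_nonneg_left hℓ2 hK₂]
    nlinarith
  have h30 : 0 ≤ τt + 3 * (K₂ * (Real.sqrt 2 * ℓ) ^ 2) := by positivity
  have T1 : C₂ * c / Λ ^ 3 * (τt + 4 * (K₂ * (Real.sqrt 2 * ℓ) ^ 2)) ^ 2 ≤ 4 * c / Λ * (ℓ ^ 2 * Nr ^ 2 * (C₂ * (bτ + 8 * K₂) ^ 2 / (4 * e₀ ^ 2))) := by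
    calc _ ≤ C₂ * c / Λ ^ 3 * (ℓ / Nr * (bτ + 8 * K₂)) ^ 2 := by gcongr
      _ = 4 * c / Λ * (ℓ ^ 2 * Nr ^ 2 * (C₂ * (bτ + 8 * K₂) ^ 2 / (4 * e₀ ^ 2))) := by rw [← hNrΛ]; field_simp
  have T2 : C₁ * c / Λ ^ 2 * (K₂ * (Real.sqrt 2 * ℓ) ^ 2) ≤ 4 * c / Λ * (ℓ ^ 2 * Nr ^ 2 * (C₁ * K₂ / (2 * e₀))) := by
    rw [hst]; refine le_of_eq ?_; rw [← hNrΛ]; field_simp; ring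
  have T3 : 2 * (a₁ * (C₁ * c / Λ ^ 2 * (τt + 3 * (K₂ * (Real.sqrt 2 * ℓ) ^ 2)))) ≤
      4 * c / Λ * (ℓ ^ 2 * Nr ^ 2 * (ab₁ * C₁ * (bτ + 6 * K₂) / (2 * e₀))) := by
    have h := mul_le_mul ha₁ (mul_le_mul_of_nonneg_left h3 (by positivity : 0 ≤ C₁ * c / Λ ^ 2)) (by positivity) (by positivity)
    calc _ ≤ 2 * (ℓ * Nr * ab₁ * (C₁ * c / Λ ^ 2 * (ℓ / Nr * (bτ + 6 * K₂)))) := by linarith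
      _ = 4 * c / Λ * (ℓ ^ 2 * Nr ^ 2 * (ab₁ * C₁ * (bτ + 6 * K₂) / (2 * e₀))) := by rw [← hNrΛ]; field_simp; ring
  have T4 : a₂ * (4 * c / Λ) ≤ 4 * c / Λ * (ℓ ^ 2 * Nr ^ 2 * ab₂) := by
    rw [mul_comm]; exact mul_le_mul_of_nonneg_left ha₂ (by positivity)
  have e : c₀ * (4 * c / Λ) * (ℓ ^ 2 * Nr ^ 2 * (C₂ * (bτ + 8 * K₂) ^ 2 / (4 * e₀ ^ 2) + C₁ * K₂ / (2 * e₀) +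
        ab₁ * C₁ * (bτ + 6 * K₂) / (2 * e₀) + ab₂)) =
      c₀ * (4 * c / Λ * (ℓ ^ 2 * Nr ^ 2 * (C₂ * (bτ + 8 * K₂) ^ 2 / (4 * e₀ ^ 2))) + 4 * c / Λ * (ℓ ^ 2 * Nr ^ 2 * (C₁ * K₂ / (2 * e₀))) +
        4 * c / Λ * (ℓ ^ 2 * Nr ^ 2 * (ab₁ * C₁ * (bτ + 6 * K₂) / (2 * e₀))) + 4 * c / Λ * (ℓ ^ 2 * Nr ^ 2 * ab₂)) := by ring
  rw [e]
  refine mul_le_mul_of_nonneg_left ?_ hc₀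
  linarith [T1, T2, T3, T4]

end Summit.HubbardSuperconductivity.HubbardSuperconductivity.Theorems.TorusFourierL2

end
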